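import Literature.Computability.Cryptography.ClassBQP
import Literature.Computability.Complexity.BoolEncodings
import Literature.NumberTheory.GaussSums.KummerSector
import HarnessLib

/-!
# Estimating the phase of a Gauss sum in quantum polynomial time (van Dam–Seroussi 2002)

Topic `Literature/Computability/Cryptography` (next to `HallgrenPell.lean`, `HallgrenClassGroup.lean`,
`Shor.lean`: quantum algorithms stated in the tree's strict model `IsQSolvable`). NAMED FACTS
(D-0014: `def … : Prop`, nothing asserted, no `sorry`) vendored while grounding route
`QuantumAdvantage/ThirdFactorialPincer` (crux `ArgLeg`, stmt-QuantumAdvantage-11644: "arg G(χ_p) =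
Kummer's sector (van Dam–Seroussi eigenphase of χ²∘F_p on |χ⟩ to ±π/12 …) — the quantum step"); the
same printed theorem is the quantum content of route `QuantumAdvantage/KummerSector` (crux `KsMemBQP`,
stmt-QuantumAdvantage-1614: "THE NEEDED FACT (no van Dam–Seroussi fact exists in Literature)"; that
route file's `route_premise` `vanDamSeroussi2002` has no declaration) and of
`QuantumAdvantage/CentralFactorial` (sign of the quartic Gauss sum).

## Source (held text `paper:arxiv-quant-ph_0207131`, read 2026-08-15; section numbers of the arXiv version)

W. van Dam, G. Seroussi, *Efficient quantum algorithms for estimating Gauss sums*,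
arXiv:quant-ph/0207131 (2002) [VanDamSeroussi2002].

* §2.1, Definition 1: for the finite field `𝔽_{p^r}`, a multiplicative character `χ` and `β ∈ 𝔽_{p^r}`,
  `G(𝔽_{p^r}, χ, β) := Σ_{x ∈ 𝔽_{p^r}} χ(x) ζ_p^{Tr(βx)}`; characters are specified by a triple
  `(p^r, g, α)`, `g` a primitive element, `χ(g^j) := ζ_{p^r-1}^{αj}`, `χ(0) := 0` (§2.1–2.2); for
  non-trivial `χ` and `β ≠ 0`, `|G(𝔽_{p^r}, χ, β)| = √(p^r)` (§2.1, last paragraph).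
* §2.2, Definition 2 (Gauss Sum Problem): "Let `𝔽_{p^r}` be a finite field, `χ` a nontrivial character
  over `𝔽_{p^r}` and `β ∈ 𝔽*_{p^r}`. What is (approximately) the angle `γ mod 2π` in the Gauss sum
  equation `G(𝔽_{p^r}, χ, β) = √(p^r) · e^{iγ}`?"
* §4, **Theorem 1** (Quantum Algorithm for Gauss Sum Estimation over `𝔽_{p^r}`): "For any `ε > 0`,
  there exists a quantum algorithm that estimates the phase `γ` in `G(𝔽_{p^r}, χ, β) = √(p^r) · e^{iγ}`,
  with expected error `E[|γ − γ̃|] < ε`. The time complexity of this algorithm is bounded by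
  `O(1/ε · polylog(p^r))`." (Algorithm 1 ibid.: `|χ⟩ ↦ (G/√(p^r))|χ⟩` under `ℱ_β` followed by
  `|y⟩ ↦ χ²(y)|y⟩`; `|χ⟩` prepared with Shor's discrete logarithm, Lemma 1.)
* §8: whether Gauss sum estimation is classically hard "even under the assumption that factoring and
  discrete logarithms are easy" is left open (context for the routes' hardness hypotheses; not vendored).

## Tree form (what is vendored, and how it is weaker than print)

`VanDamSeroussi2002_gaussSumPhase_qsolvable`: the PRIME-FIELD case `r = 1` of Theorem 1, at every FIXED
precision. For each `t ≥ 1`, the search problem "on input `⟨bin p, ⟨bin g, ⟨bin a, bin b⟩⟩⟩` (pairing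
`boolPair` of `Literature.Computability.Complexity.BoolEncodings`, binary `Computability.encodeNat`) with `p` prime,
`g` a primitive root mod `p`, `0 < a < p − 1` (so `χ` is non-trivial) and `0 < b < p`, output (as a
prefix of the measured string) `bin m` for some `m < t` with `|arg(G · e^{−2πi m/t})| ≤ 2π/t`", where
`G = Σ_{z<p} χ(z) e^{2πi bz/p}` and `χ` is THE multiplicative character of `𝔽_p` with
`χ(g) = e^{2πi a/(p−1)}` (a `MulChar (ZMod p) ℂ` is determined by its value at the generator `g`;
Mathlib's `MulChar` sends `0 ↦ 0`, the paper's convention), is `IsQSolvable` — a `P`-uniform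
oracle-free Clifford+T family succeeding with probability `≥ 2/3` (the model of `factoring_mem_FBQP`,
`Hallgren2007_regulator_qsolvable`). This follows from the printed statement by Markov's inequality
(run Theorem 1 with `ε = π/(3t)`: the estimate is within `π/t` of `γ` with probability `≥ 2/3`; round it
to the nearest grid point `2πm/t`, which is then within `2π/t` of `γ` modulo `2π`, i.e.
`|arg(G e^{−2πim/t})| ≤ 2π/t` since `G ≠ 0`). WEAKER than printed: prime fields only, one family per
precision `t` (the printed running time is uniform in `1/ε`), success `2/3`. Inputs off the promise
carry no requirement. The Gauss sum is written as an explicit finite sum (it is Mathlib's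
`gaussSum χ (ZMod.stdAddChar.mulShift b)`, cf. `Literature.NumberTheory.GaussSums.cubicGaussSum_eq_gaussSum`
for the cubic case), so that no `NeZero p` instance is needed inside the binder.

`VanDamSeroussi2002_cubicGaussSumPhase_qsolvable`: the same theorem at the triple
`(p, g, α) = (p, r, (p−1)/3)`, `β = 1`, i.e. for the cubic residue character `χ_{p,r}` of
`Literature.NumberTheory.GaussSums.KummerSector` (`cubicChar`, `cubicGaussSum`; `χ_{p,r}(r) = ω`,
[VanDamSeroussi2002, §2.1] is cited there for exactly this parametrisation): on input `⟨bin p, bin r⟩`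
with `p ≡ 1 (mod 3)` prime and `r` a primitive root, output `m < t` with
`|arg(g(χ_{p,r}) e^{−2πim/t})| ≤ 2π/t`. This is the quantum step of `KsMemBQP` (route KummerSector:
`t = 12` separates the three candidate sectors `2π/3` apart) and of `ArgLeg` (route
ThirdFactorialPincer, `t = 72`); stated separately because those items consume precisely this shape
(fact ∘ specialisation; the reduction to the general form is a classical re-encoding of the input,
`(p, r) ↦ (p, r, (p−1)/3, 1)`).

Not in Mathlib (no quantum complexity classes); no van Dam–Seroussi declaration existed in the tree
(searched `vanDam|Seroussi|GaussSumPhase`, 2026-08-15: docstring mentions only).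

## References

* [VanDamSeroussi2002] W. van Dam, G. Seroussi, arXiv:quant-ph/0207131, §2.1–2.2 (Def. 1–2), §4
  (Algorithm 1, Theorem 1), §8.
* K. Ireland, M. Rosen, *A Classical Introduction to Modern Number Theory*, GTM 84, Ch. 8 §2 (Gauss
  sums), Ch. 9 §12 (Kummer's problem) [IrelandRosen1990] — context.
-/

noncomputable section

namespace Literature.Computability.Cryptography

open _root_.Computability
open Literature.Computability.Complexity (boolPair)
open Literature.NumberTheory.GaussSums (cubicGaussSum)

/-- **van Dam–Seroussi 2002, Theorem 1 (prime-field case, fixed precision): the phase of a Gauss sum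
over `𝔽_p` can be estimated in quantum polynomial time.** Printed (§4, Thm 1): "For any `ε > 0`, there
exists a quantum algorithm that estimates the phase `γ` in `G(𝔽_{p^r}, χ, β) = √(p^r)·e^{iγ}`, with
expected error `E[|γ − γ̃|] < ε`. The time complexity of this algorithm is bounded by
`O(1/ε · polylog(p^r))`", where `G(𝔽_{p^r}, χ, β) = Σ_x χ(x) ζ_p^{Tr(βx)}` (Def. 1), `χ` non-trivial is
given by a triple `(p^r, g, α)`, `χ(g^j) = ζ_{p^r−1}^{αj}`, `χ(0) = 0`, and `β ≠ 0` (Def. 2). Tree form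
(`r = 1`): for every `t ≥ 1` the search problem `⟨bin p, ⟨bin g, ⟨bin a, bin b⟩⟩⟩ ↦ bin m` with
`m < t` and `|arg(G · e^{−2πim/t})| ≤ 2π/t`, on the promise `p` prime, `g` a primitive root mod `p`,
`0 < a < p−1`, `0 < b < p`, `χ` the character of `(ℤ/p)ˣ` with `χ(g) = e^{2πia/(p−1)}` and
`G = Σ_{z<p} χ(z) e^{2πibz/p}` (no requirement on other inputs), is `IsQSolvable`. Weaker than printed
(prime fields; one uniform family per precision `t`; success `2/3`, from the expected-error bound by
Markov and rounding to the grid `2πℤ/t`). Grounds the quantum step of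
`Summit.QuantumAdvantage.QuantumAdvantage.Theses.ThirdFactorialPincer.ArgLeg` and of
`Summit.QuantumAdvantage.QuantumAdvantage.Theses.KummerSector.KsMemBQP`.
[cite: VanDamSeroussi2002, §4 Theorem 1 with §2.1 Def. 1 and §2.2 Def. 2] -/
def VanDamSeroussi2002_gaussSumPhase_qsolvable : Prop :=
  ∀ t : ℕ, 0 < t →
    IsQSolvable fun x : List Bool =>
      {y | ∀ (p g a b : ℕ) (χ : MulChar (ZMod p) ℂ), p.Prime →
        x = boolPair (encodeNat p) (boolPair (encodeNat g) (boolPair (encodeNat a) (encodeNat b))) →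
          IsPrimitiveRoot (g : ZMod p) (p - 1) → 0 < a → a < p - 1 → 0 < b → b < p →
            χ (g : ZMod p) = Complex.exp (2 * Real.pi * Complex.I * (a : ℂ) / ((p : ℂ) - 1)) →
              ∃ m : ℕ, m < t ∧
                |Complex.arg
                    ((∑ z ∈ Finset.range p,
                        χ (z : ZMod p) * Complex.exp (2 * Real.pi * Complex.I * ((b * z : ℕ) : ℂ) / (p : ℂ))) *
                      Complex.exp (-(2 * Real.pi * Complex.I * (m : ℂ) / (t : ℂ))))| ≤
                  2 * Real.pi / t ∧
                encodeNat m <+: y}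

/-- **van Dam–Seroussi 2002, Theorem 1, for the cubic residue character** (the triple
`(p, g, α) = (p, r, (p−1)/3)`, `β = 1`, of [VanDamSeroussi2002, §2.1], i.e. the character `χ_{p,r}`
with `χ_{p,r}(r) = ω` of `Literature.NumberTheory.GaussSums.cubicChar` and its Gauss sum
`g(χ_{p,r}) = Σ_{a<p} χ_{p,r}(a) e^{2πia/p} = Literature.NumberTheory.GaussSums.cubicGaussSum p r`):
for every `t ≥ 1` the search problem `⟨bin p, bin r⟩ ↦ bin m` with `m < t` and
`|arg(g(χ_{p,r}) · e^{−2πim/t})| ≤ 2π/t`, on the promise `p` prime, `p ≡ 1 (mod 3)`, `r` a primitive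
root mod `p` (no requirement otherwise), is `IsQSolvable`. Specialisation of
`VanDamSeroussi2002_gaussSumPhase_qsolvable` (classical re-encoding `(p, r) ↦ (p, r, (p−1)/3, 1)`),
in the shape consumed by `Summit.QuantumAdvantage.QuantumAdvantage.Theses.KummerSector.KsMemBQP`
(`t = 12`: the three candidate sectors are `2π/3` apart) and by the argument leg
`Summit.QuantumAdvantage.QuantumAdvantage.Theses.ThirdFactorialPincer.ArgLeg` (`t = 72`).
[cite: VanDamSeroussi2002, §4 Theorem 1 at (p, g, α) = (p, r, (p-1)/3), β = 1 (§2.1)] -/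
def VanDamSeroussi2002_cubicGaussSumPhase_qsolvable : Prop :=
  ∀ t : ℕ, 0 < t →
    IsQSolvable fun x : List Bool =>
      {y | ∀ p r : ℕ, p.Prime → x = boolPair (encodeNat p) (encodeNat r) → p % 3 = 1 →
        IsPrimitiveRoot (r : ZMod p) (p - 1) →
          ∃ m : ℕ, m < t ∧
            |Complex.arg (cubicGaussSum p r *
                Complex.exp (-(2 * Real.pi * Complex.I * (m : ℂ) / (t : ℂ))))| ≤ 2 * Real.pi / t ∧
            encodeNat m <+: y}

end Literature.Computability.Cryptography
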